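import Mathlib.Analysis.InnerProductSpace.PiL2
import Mathlib.Analysis.Complex.Basic
import Mathlib.Analysis.Meromorphic.Order
import Mathlib.Analysis.Analytic.Constructions
import Mathlib.Analysis.Calculus.Deriv.Inv
import Mathlib.Geometry.Manifold.Instances.Real
import Mathlib.Tactic

/-!
# The sphere at infinity `V∞` meets every flat `H`-leaf `{T_H = t}`, `t ≠ 0`, exactly once
(registered helper `helper_vinfLevelHCount` of line `cross-cap-laurent`, crux
`GromovRecognitionRelEnd`, item stmt-SmoothPoincare4-11009)

In the wedge cap `X` the cap charts `ηV, ηH, ηC : ℝ⁴ → X` live on the polydiscs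
`D_V = {p 0 ^ 2 + p 1 ^ 2 < R₁⁻¹ ^ 2}`, `D_H = {p 2 ^ 2 + p 3 ^ 2 < R₁⁻¹ ^ 2}` and `D_C = D_V ∩ D_H`
(`(p 0, p 1)` is the first complex factor, `(p 2, p 3)` the second); off the axes they are glued to
`ι ∘ χ`, resp. to each other, by complex inversion of one factor:
`ηH (z₁, s) = ι (χ (z₁, 1/s))` and `ηC (z₁, s) = ηV (z₁, 1/s)` for `s ≠ 0`.  The wedge coordinate
`T : X → ℂ` near `H∞` reads the second factor, `T (ηC p) = p 2 + i p 3` on `D_C`, and its level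
sets inside `U_H = ηH '' D_H ∪ ηC '' D_C` are the flat leaves closed up by one corner point,
`{y ∈ U_H | T y = t} = {ηH (z, t) | z : ℂ} ∪ {ηC (0, t)}` (`‖t‖ < R₁⁻¹`; this is the conclusion
of the neighbouring helper `helper_wedgeLevelSetH`, taken here as a hypothesis).  The sphere at
infinity `V∞` is the two-chart sphere `u z = ηV (0, 0, z)`, `v 0 = ηC 0`, `v w = u w⁻¹` (`w ≠ 0`).

The intersection count of a two-chart sphere `(u, v)` with the leaf `{T = t}` is the sum of the
meromorphic orders of `(T - t) ∘ u` over the parameters `z` with `u z ∈ U_H`, `T (u z) = t`, plus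
the order of `(T - t) ∘ v` at `w = 0` when `v 0` lies on the leaf.  We prove that for `t ≠ 0`,
`‖t‖ < R₁⁻¹`, this count is exactly `1`:

* the chart at infinity does not contribute: `v 0 = ηC 0` and `T (ηC 0) = 0 ≠ t`;
* the affine index set is the singleton `{t⁻¹}`: a point `u z = ηV (0, 0, z)` of the leaf is either
  `ηH (z', t)`, which lies in `range ι` because `t ≠ 0` (gluing clause for `ηH`) whereas the
  `V`-axis point `ηV (0, 0, z)` does not, or the corner point `ηC (0, t) = ηV (0, 0, t⁻¹) = u t⁻¹`
  (gluing clause for `ηC`), and then `z = t⁻¹` by injectivity of `ηV` on `D_V`;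
* near `z₀ = t⁻¹` (where `‖z‖ > R₁`, so `‖z⁻¹‖ < R₁⁻¹`) the same gluing clause gives
  `u z = ηC (0, 0, z⁻¹)`, hence `T (u z) - t = z⁻¹ - t`: by locality of the meromorphic order
  (`meromorphicOrderAt_congr`) and its invariance under the analytic change of variable `z ↦ z⁻¹`
  (`meromorphicOrderAt_comp_of_deriv_ne_zero`) the order at `t⁻¹` is the order of `w ↦ w - t` at
  `t`, namely `1` (`meromorphicOrderAt_id_sub_const`).

Everything is proved from Mathlib's `finsum` and meromorphic-order API; no definition, no named
fact.

References: D. McDuff, D. Salamon, *J-holomorphic Curves and Symplectic Topology*, 2nd ed. (2012),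
§2.6 and App. E (local intersection index as order of vanishing); M. Gromov, *Pseudo holomorphic
curves in symplectic manifolds*, Invent. Math. 82 (1985), 2.4.A₁′.
-/

-- the registered namespace `Summit.SmoothPoincare4.SmoothPoincare4.Theorems…` repeats a component
set_option linter.dupNamespace false

open scoped Manifold ContDiff Topology
open Set Filter

namespace Summit.SmoothPoincare4.SmoothPoincare4.Theorems.GromovRecognitionRelEnd.CrossCapLaurent

/-- For `‖w‖ < R₁⁻¹`, the real coordinates of `w` lie in the disc of radius `R₁⁻¹`:
`w.re ^ 2 + w.im ^ 2 < R₁⁻¹ ^ 2`. -/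
private lemma vinfLevelH_re_sq_add_im_sq_lt {R₁ : ℝ} {w : ℂ} (hw : ‖w‖ < R₁⁻¹) :
    w.re ^ 2 + w.im ^ 2 < R₁⁻¹ ^ 2 := by
  have h : w.re ^ 2 + w.im ^ 2 = ‖w‖ ^ 2 := by
    rw [← Complex.normSq_eq_norm_sq, Complex.normSq_apply]
    ring
  rw [h]
  exact pow_lt_pow_left₀ hw (norm_nonneg w) two_ne_zero

/-- **The corner chart along the second factor is the affine chart of `V∞` read through `1/w`.**
For `0 < ‖w‖ < R₁⁻¹` the point `(0, 0, w.re, w.im)` lies in the corner bidisc `D_C`, the gluing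
clause `ηC (z₁, s) = ηV (z₁, 1/s)` gives `ηC (0, 0, w.re, w.im) = ηV (0, 0, w⁻¹) = u w⁻¹`, and the
wedge coordinate reads `T (ηC (0, 0, w.re, w.im)) = w`. -/
private lemma vinfLevelH_corner {X : Type} {R₁ : ℝ} {ηV ηC : EuclideanSpace ℝ (Fin 4) → X}
    {T : X → ℂ} {u : ℂ → X} (hR₁ : 0 < R₁)
    (hglue : ∀ p : EuclideanSpace ℝ (Fin 4), p 0 ^ 2 + p 1 ^ 2 < R₁⁻¹ ^ 2 →
      p 2 ^ 2 + p 3 ^ 2 < R₁⁻¹ ^ 2 → (p 2 ≠ 0 ∨ p 3 ≠ 0) →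
      ηC p = ηV (WithLp.toLp 2
        ![p 0, p 1, p 2 / (p 2 ^ 2 + p 3 ^ 2), -(p 3) / (p 2 ^ 2 + p 3 ^ 2)]))
    (hT : ∀ p : EuclideanSpace ℝ (Fin 4), p 0 ^ 2 + p 1 ^ 2 < R₁⁻¹ ^ 2 →
      p 2 ^ 2 + p 3 ^ 2 < R₁⁻¹ ^ 2 → T (ηC p) = ⟨p 2, p 3⟩)
    (hu : ∀ z : ℂ, u z = ηV (WithLp.toLp 2 ![0, 0, z.re, z.im]))
    {w : ℂ} (hw0 : w ≠ 0) (hw : ‖w‖ < R₁⁻¹) :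
    ηC (WithLp.toLp 2 ![0, 0, w.re, w.im]) = u w⁻¹ ∧
      (WithLp.toLp 2 ![0, 0, w.re, w.im] : EuclideanSpace ℝ (Fin 4)) ∈
        {p : EuclideanSpace ℝ (Fin 4) | p 0 ^ 2 + p 1 ^ 2 < R₁⁻¹ ^ 2 ∧
          p 2 ^ 2 + p 3 ^ 2 < R₁⁻¹ ^ 2} ∧
      T (ηC (WithLp.toLp 2 ![0, 0, w.re, w.im])) = w := by
  have hR : (0 : ℝ) < R₁⁻¹ ^ 2 := by positivity
  have hnorm : w.re ^ 2 + w.im ^ 2 < R₁⁻¹ ^ 2 := vinfLevelH_re_sq_add_im_sq_lt hw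
  have hsq : Complex.normSq w = w.re ^ 2 + w.im ^ 2 := by
    rw [Complex.normSq_apply]
    ring
  set p : EuclideanSpace ℝ (Fin 4) := WithLp.toLp 2 ![0, 0, w.re, w.im] with hp
  have hp0 : p 0 = 0 := by simp [hp]
  have hp1 : p 1 = 0 := by simp [hp]
  have hp2 : p 2 = w.re := by simp [hp]
  have hp3 : p 3 = w.im := by simp [hp]
  have hpC : p 0 ^ 2 + p 1 ^ 2 < R₁⁻¹ ^ 2 := by
    rw [hp0, hp1]
    simpa using hR
  have hpD : p 2 ^ 2 + p 3 ^ 2 < R₁⁻¹ ^ 2 := by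
    rw [hp2, hp3]
    exact hnorm
  have hp23 : p 2 ≠ 0 ∨ p 3 ≠ 0 := by
    rw [hp2, hp3]
    exact not_and_or.mp fun h => hw0 (Complex.ext (by simpa using h.1) (by simpa using h.2))
  refine ⟨?_, ⟨hpC, hpD⟩, ?_⟩
  · rw [hglue p hpC hpD hp23, hu, hp0, hp1, hp2, hp3, Complex.inv_re, Complex.inv_im, hsq]
  · rw [hT p hpC hpD, hp2, hp3]

/-- **Registered helper `helper_vinfLevelHCount`** (line `cross-cap-laurent`, signature verbatim):
for `t ≠ 0` with `‖t‖ < R₁⁻¹`, the sphere at infinity `V∞` (`u z = ηV (0, 0, z)`, `v 0 = ηC 0`,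
`v w = u w⁻¹`) meets the flat `H`-leaf `{T = t}` with intersection count exactly `1`.  With
`U_H = ηH '' D_H ∪ ηC '' D_C`, `{y ∈ U_H | T y = t} = {ηH (z, t)} ∪ {ηC (0, t)}`,
`T (ηC p) = p 2 + i p 3` on `D_C`, the gluing clauses `ηH p = ι (χ (p 0, p 1, (p 2, p 3)⁻¹))`,
`ηC p = ηV (p 0, p 1, (p 2, p 3)⁻¹)` off the axis `p 2 = p 3 = 0`, injectivity of `ηV` on `D_V`
and disjointness of the `V`-axis from
`range ι`: the chart at infinity does not contribute (`T (v 0) = T (ηC 0) = 0 ≠ t`), the affine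
index set is `{t⁻¹}`, and there `(T - t) ∘ u` agrees near `t⁻¹` with `z ↦ z⁻¹ - t`, of meromorphic
order `1`.  See the file header. [folklore; cf. McDuff–Salamon 2012, §2.6] -/
theorem helper_vinfLevelHCount : ∀ (X : Type) [TopologicalSpace X] [ChartedSpace (EuclideanSpace ℝ (Fin 4)) X] [IsManifold (𝓡 4) ∞ X] (M : Type) (R₁ : ℝ) (χ : EuclideanSpace ℝ (Fin 4) → M) (ι : M → X) (ηH ηV ηC : EuclideanSpace ℝ (Fin 4) → X) (T : X → ℂ) (u v : ℂ → X), 0 < R₁ → Set.InjOn ηV {p : EuclideanSpace ℝ (Fin 4) | p 0 ^ 2 + p 1 ^ 2 < R₁⁻¹ ^ 2} → (∀ p : EuclideanSpace ℝ (Fin 4), p 0 = 0 → p 1 = 0 → ηV p ∉ Set.range ι) → (∀ p : EuclideanSpace ℝ (Fin 4), p 2 ^ 2 + p 3 ^ 2 < R₁⁻¹ ^ 2 → (p 2 ≠ 0 ∨ p 3 ≠ 0) → ηH p = ι (χ (WithLp.toLp 2 ![p 0, p 1, p 2 / (p 2 ^ 2 + p 3 ^ 2), -(p 3) / (p 2 ^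 2 + p 3 ^ 2)]))) → (∀ p : EuclideanSpace ℝ (Fin 4), p 0 ^ 2 + p 1 ^ 2 < R₁⁻¹ ^ 2 → p 2 ^ 2 + p 3 ^ 2 < R₁⁻¹ ^ 2 → (p 2 ≠ 0 ∨ p 3 ≠ 0) → ηC p = ηV (WithLp.toLp 2 ![p 0, p 1, p 2 / (p 2 ^ 2 + p 3 ^ 2), -(p 3) / (p 2 ^ 2 + p 3 ^ 2)])) → (∀ p : EuclideanSpace ℝ (Fin 4), p 0 ^ 2 + p 1 ^ 2 < R₁⁻¹ ^ 2 → p 2 ^ 2 + p 3 ^ 2 < R₁⁻¹ ^ 2 → T (ηC p) = ⟨p 2, p 3⟩) → (∀ t : ℂ, ‖t‖ < R₁⁻¹ → {y : X | y ∈ (ηH '' {p : EuclideanSpace ℝ (Fin 4) | p 2 ^ 2 + p 3 ^ 2 < R₁⁻¹ ^ 2} ∪ ηC '' {p : EuclideanSpace ℝ (Fin 4) | p 0 ^ 2 + p 1 ^ 2 < R₁⁻¹ ^ 2 ∧ p 2 ^ 2 + p 3 ^ 2 < R₁⁻¹ ^ 2}) ∧ T y = t} = Set.range (fun z : ℂ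 => ηH (WithLp.toLp 2 ![z.re, z.im, t.re, t.im])) ∪ {ηC (WithLp.toLp 2 ![0, 0, t.re, t.im])}) → (∀ z : ℂ, u z = ηV (WithLp.toLp 2 ![0, 0, z.re, z.im])) → v 0 = ηC 0 → (∀ w : ℂ, w ≠ 0 → v w = u w⁻¹) → ∀ t : ℂ, t ≠ 0 → ‖t‖ < R₁⁻¹ → (∑ᶠ z ∈ {z : ℂ | u z ∈ (ηH '' {p : EuclideanSpace ℝ (Fin 4) | p 2 ^ 2 + p 3 ^ 2 < R₁⁻¹ ^ 2} ∪ ηC '' {p : EuclideanSpace ℝ (Fin 4) | p 0 ^ 2 + p 1 ^ 2 < R₁⁻¹ ^ 2 ∧ p 2 ^ 2 + p 3 ^ 2 < R₁⁻¹ ^ 2}) ∧ (fun y => T y - t) (u z) = 0}, (meromorphicOrderAt ((fun y => T y - t) ∘ u) z).untop₀) + (∑ᶠ w ∈ {w : ℂ | w = 0 ∧ v w ∈ (ηH '' {p : EuclideanSpace ℝ (Fin 4) | p 2 ^ 2 + p 3 ^ 2 < R₁⁻¹ ^ 2} ∪ ηC '' {p : EuclideanSpace ℝ (Fin 4) | p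 0 ^ 2 + p 1 ^ 2 < R₁⁻¹ ^ 2 ∧ p 2 ^ 2 + p 3 ^ 2 < R₁⁻¹ ^ 2}) ∧ (fun y => T y - t) (v w) = 0}, (meromorphicOrderAt ((fun y => T y - t) ∘ v) w).untop₀) = 1 := by
  intro X _ _ _ M R₁ χ ι ηH ηV ηC T u v hR₁ hinj hVax hHglue hCglue hT hlevel hu hv0 _ t ht htR
  beta_reduce
  -- the two chart domains `D_H`, `D_C` (so that `U_H = ηH '' DH ∪ ηC '' DC`)
  set DH : Set (EuclideanSpace ℝ (Fin 4)) :=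
    {p : EuclideanSpace ℝ (Fin 4) | p 2 ^ 2 + p 3 ^ 2 < R₁⁻¹ ^ 2} with hDH
  set DC : Set (EuclideanSpace ℝ (Fin 4)) :=
    {p : EuclideanSpace ℝ (Fin 4) | p 0 ^ 2 + p 1 ^ 2 < R₁⁻¹ ^ 2 ∧ p 2 ^ 2 + p 3 ^ 2 < R₁⁻¹ ^ 2}
    with hDC
  have hR : (0 : ℝ) < R₁⁻¹ ^ 2 := by positivity
  have htt : t.re ^ 2 + t.im ^ 2 < R₁⁻¹ ^ 2 := vinfLevelH_re_sq_add_im_sq_lt htR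
  have ht23 : t.re ≠ 0 ∨ t.im ≠ 0 :=
    not_and_or.mp fun h => ht (Complex.ext (by simpa using h.1) (by simpa using h.2))
  -- (1) the chart at infinity does not contribute: `T (v 0) = T (ηC 0) = 0 ≠ t`
  have hD0 : (0 : EuclideanSpace ℝ (Fin 4)) ∈ DC := by
    refine ⟨?_, ?_⟩ <;> simpa using hR
  have hT0 : T (ηC 0) = 0 := by
    rw [hT 0 hD0.1 hD0.2]
    exact Complex.ext (by simp) (by simp)
  have hS₂ : {w : ℂ | w = 0 ∧ v w ∈ (ηH '' DH ∪ ηC '' DC) ∧ T (v w) - t = 0} = ∅ := by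
    refine Set.eq_empty_of_forall_notMem fun w hw => ?_
    obtain ⟨rfl, -, hw⟩ := hw
    rw [hv0, hT0, zero_sub, neg_eq_zero] at hw
    exact ht hw
  -- (2) the affine index set is the singleton `{t⁻¹}`
  obtain ⟨hCt, htD, hTt⟩ := vinfLevelH_corner hR₁ hCglue hT hu ht htR
  have hS₁ : {z : ℂ | u z ∈ (ηH '' DH ∪ ηC '' DC) ∧ T (u z) - t = 0} = {t⁻¹} := by
    ext z
    simp only [Set.mem_setOf_eq, Set.mem_singleton_iff]
    constructor
    · rintro ⟨hzU, hzT⟩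
      have hmem : u z ∈ Set.range (fun z : ℂ => ηH (WithLp.toLp 2 ![z.re, z.im, t.re, t.im])) ∪
          {ηC (WithLp.toLp 2 ![0, 0, t.re, t.im])} := by
        rw [← hlevel t htR]
        exact ⟨hzU, sub_eq_zero.mp hzT⟩
      rcases hmem with ⟨a, ha⟩ | h0
      · -- `u z = ηH (a, t)` lies in `range ι` (as `t ≠ 0`), but the `V`-axis misses `range ι`
        exfalso
        have hqD : (WithLp.toLp 2 ![a.re, a.im, t.re, t.im] : EuclideanSpace ℝ (Fin 4)) 2 ^ 2 +
            (WithLp.toLp 2 ![a.re, a.im, t.re, t.im] : EuclideanSpace ℝ (Fin 4)) 3 ^ 2 <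
              R₁⁻¹ ^ 2 := by
          simpa using htt
        have hq23 : (WithLp.toLp 2 ![a.re, a.im, t.re, t.im] : EuclideanSpace ℝ (Fin 4)) 2 ≠ 0 ∨
            (WithLp.toLp 2 ![a.re, a.im, t.re, t.im] : EuclideanSpace ℝ (Fin 4)) 3 ≠ 0 := by
          simpa using ht23
        have hι : u z ∈ Set.range ι := by
          rw [← ha]
          exact ⟨_, (hHglue _ hqD hq23).symm⟩
        rw [hu z] at hι
        exact hVax _ (by simp) (by simp) hι
      · -- `u z = ηC (0, t) = u t⁻¹`, and `ηV` is injective on `D_V`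
        rw [Set.mem_singleton_iff, hCt, hu, hu] at h0
        have hpq := hinj (by simpa using hR) (by simpa using hR) h0
        apply Complex.ext
        · simpa using congrArg (fun q : EuclideanSpace ℝ (Fin 4) => q 2) hpq
        · simpa using congrArg (fun q : EuclideanSpace ℝ (Fin 4) => q 3) hpq
    · rintro rfl
      rw [← hCt, hTt, sub_self]
      exact ⟨Or.inr ⟨_, htD, rfl⟩, rfl⟩
  -- (3) near `t⁻¹`, `(T - t) ∘ u` is `z ↦ z⁻¹ - t`, of meromorphic order `1` at `t⁻¹`
  have hord : meromorphicOrderAt ((fun y => T y - t) ∘ u) t⁻¹ = 1 := by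
    have hopen : IsOpen {z : ℂ | R₁ < ‖z‖} := isOpen_lt continuous_const continuous_norm
    have hmem : t⁻¹ ∈ {z : ℂ | R₁ < ‖z‖} := by
      rw [Set.mem_setOf_eq, norm_inv]
      exact (lt_inv_comm₀ hR₁ (norm_pos_iff.mpr ht)).mpr htR
    have hev : ((fun y => T y - t) ∘ u) =ᶠ[𝓝 t⁻¹] ((fun w : ℂ => w - t) ∘ fun z : ℂ => z⁻¹) := by
      filter_upwards [hopen.mem_nhds hmem] with z hz
      have hz0 : z ≠ 0 := norm_pos_iff.mp (hR₁.trans hz)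
      have hzi : ‖z⁻¹‖ < R₁⁻¹ := by
        rw [norm_inv]
        exact inv_strictAnti₀ hR₁ hz
      obtain ⟨hCz, -, hTz⟩ := vinfLevelH_corner hR₁ hCglue hT hu (inv_ne_zero hz0) hzi
      rw [inv_inv] at hCz
      simp only [Function.comp_apply]
      rw [← hCz, hTz]
    have hg : AnalyticAt ℂ (fun z : ℂ => z⁻¹) t⁻¹ := analyticAt_inv (inv_ne_zero ht)
    have hg' : deriv (fun z : ℂ => z⁻¹) t⁻¹ ≠ 0 := by
      rw [deriv_inv]
      exact neg_ne_zero.mpr (inv_ne_zero (pow_ne_zero 2 (inv_ne_zero ht)))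
    have hcomp : meromorphicOrderAt ((fun w : ℂ => w - t) ∘ fun z : ℂ => z⁻¹) t⁻¹ =
        meromorphicOrderAt (fun w : ℂ => w - t) (t⁻¹)⁻¹ :=
      meromorphicOrderAt_comp_of_deriv_ne_zero hg hg'
    rw [meromorphicOrderAt_congr (hev.filter_mono nhdsWithin_le_nhds), hcomp, inv_inv]
    exact meromorphicOrderAt_id_sub_const
  -- assemble: `1 + 0 = 1`
  rw [hS₁, hS₂, finsum_mem_empty, finsum_mem_singleton, hord, add_zero]
  rfl

end Summit.SmoothPoincare4.SmoothPoincare4.Theorems.GromovRecognitionRelEnd.CrossCapLaurent
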